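import Mathlib
import HarnessLib
import Literature.Analysis.Calculus.ExpNegInvGlueGevrey
import Summits.HubbardSuperconductivity.HubbardSuperconductivity.Theorems.KLProgrammeC4aPPKernelMidCalculus

/-!
# Route `KLProgramme` — crux C4a, S3 brick (B4) «(B4)-UMK1», «PIECES ALL ORDERS» part 1: the smooth floor `m̃(u) = √(u²+lo²)` and the split ratio
# `r(e,u) = m̃(e)/(m̃(e)+m̃(u))` have GEVREY-2 jets at EVERY order — `|∂ᵤⁿ m̃| ≤ (n!)²·m̃·m̃^{−n}`, `|∂ᵤⁿ r| ≤ (n!)²·(2/m̃(u))ⁿ`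

Cell `gate-hubbard-kl`, seat hubbard-kl-k3c3-p1 (g20; row «δμ-flow with klAngularMean constant piece»).  After «(U1)-K-JETS-ALL-ORDERS» (`…C4aPPKernelTrueJets{Core,AllOrders,Joint}`:
`|∂ᵤᵏP(e,u)| ≤ C_k·max(Λ,|u|)^{−(k+1)}` for the true kernel), the one-partition pieces `A_s = P·κ(r)`, `M_s = P·(1 − κ(r) − κ(1−r))` of `…C4aPPKernelSmoothPartition`
(k3c3-p3 g39 word l.13570: «same for the `A_s, M_s`/bumped Leibniz rows», pen (R559) ADOPTED) need the `u`-jets of the partition at every order.  The order-`≤ 2` calculus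
is `…C4aPPKernelMidCalculus` (`r′`, `r″` by hand); here ALL orders:
* §1 the combinatorial lemma `factorial_succ_mul_factorial_sub_le` (`(i+1)!·(n−i)! ≤ n!` for `i < n`) and `iteratedDeriv_sq_add_const` (the jets of `u ↦ u²+lo²`);
* §2 **`abs_iteratedDeriv_ppSmoothScale_le`** — `|∂ᵤⁿ m̃(u)| ≤ (n!)²·m̃(u)·(1/m̃(u))ⁿ` for EVERY `n` and every `u` (`0 < lo`): strong induction on the Leibniz identity
  `Σᵢ C(n,i)·∂ⁱm̃·∂ⁿ⁻ⁱm̃ = ∂ⁿ(u²+lo²)` (Mathlib `iteratedDeriv_fun_mul`), the two end terms `2m̃·∂ⁿm̃` isolated, the middle ones bounded by the hypothesis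
  (`C(n,i)(i!)²((n−i)!)² = n!·i!(n−i)! ≤ n!·(n−1)!`); the homogeneity `m̃^{1−n}` is exact (no level box, no `lo`-dependence of the constant);
* §3 **`abs_iteratedDeriv_ppSmoothRatio_le`** — `|∂ᵤⁿ r(e,·)(u)| ≤ (n!)²·(2/m̃(u))ⁿ` for every `n, e, u`: `r = m̃ₑ·(m̃ₑ+m̃)⁻¹` and the Gevrey-2 RECIPROCAL RULE
  `Literature…ExpNegInvGlueGevrey.abs_iteratedDeriv_inv_le_of_gevrey_two` (`d = m̃ₑ+m̃ᵤ`, `B = m̃ᵤ`, `σ = 1/m̃ᵤ`, `σ(1+B/d) ≤ 2/m̃ᵤ`); the complementary ratio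
  `abs_iteratedDeriv_one_sub_ppSmoothRatio_le` (`1 − r`, orders `≥ 1`: same bound); the ZONE form `abs_iteratedDeriv_ppSmoothRatio_le_of_zone`
  (`c·(m̃ₑ+m̃ᵤ) ≤ m̃ᵤ ⟹ ≤ (n!)²·(2/c)ⁿ·(m̃ₑ+m̃ᵤ)^{−n}` — the transition zones of `κ(r)`, `κ(1−r)` are of this kind) and the level form
  `inv_ppSmoothScale_add_pow_le` (`(m̃ₑ+m̃ᵤ)^{−n} ≤ (max |e| |u|)^{−n}`, `e ≠ 0`).
Part 2 (`…C4aPPKernelSplitProfileJets`): `κ∘r`, `κ∘(1−r)` at all orders (Faà di Bruno) and their vanishing off the transition zones; part 3: the pieces.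
Pure real analysis on landed objects; nothing asserts (C), any engine row, K3, the window or superconductivity.
References: BGM 2006 §2.4 (2.36) [cite: BenfattoGiulianiMastropietro2006]; Disertori–Rivasseau 2000 §II.2 (II.14) footnote (Gevrey cutoffs) [cite: DisertoriRivasseau2000].
-/

noncomputable section

namespace Summit.HubbardSuperconductivity.HubbardSuperconductivity.Theorems.C4a

set_option linter.dupNamespace false -- summit = problem name (single-conjunct summit), D-0017

open Real Filter Set Finset
open scoped Topology Nat
open Literature.MathematicalPhysics.QuantumLattice Literature.Analysis.SpecialFunctions Literature.Analysis.Calculus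

/-! ## §1 Combinatorics and the jets of `u ↦ u² + lo²` -/

/-- `(i+1)!·(n−i)! ≤ n!` for `i < n` (equivalently `C(n+1,i+1) ≥ n+1`). [folklore] -/
theorem factorial_succ_mul_factorial_sub_le : ∀ n i : ℕ, i < n → (i + 1)! * (n - i)! ≤ n ! := by
  intro n
  induction n with
  | zero => intro i hi; exact absurd hi (Nat.not_lt_zero i)
  | succ n ih =>
    intro i hi
    rcases Nat.lt_succ_iff_lt_or_eq.1 hi with hlt | heq
    · have h1 := ih i hlt
      have h2 : (n + 1 - i)! = (n - i + 1) * (n - i)! := by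
        rw [show n + 1 - i = n - i + 1 by omega, Nat.factorial_succ]
      rw [h2, Nat.factorial_succ]
      calc (i + 1)! * ((n - i + 1) * (n - i)!) = (n - i + 1) * ((i + 1)! * (n - i)!) := by ring
        _ ≤ (n + 1) * n ! := Nat.mul_le_mul (by omega) h1
    · subst heq
      simp [Nat.factorial_succ]

/-- The real form: `C(n+1,i+1)·((i+1)!)²·((n−i)!)² ≤ (n+1)!·n!` for `i < n`. [folklore] -/
theorem choose_mul_sq_factorial_le {n i : ℕ} (hi : i < n) :
    ((n + 1).choose (i + 1) : ℝ) * ((i + 1)! : ℝ) ^ 2 * ((n - i)! : ℝ) ^ 2 ≤ (n + 1)! * n ! := by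
  have h1 : ((n + 1).choose (i + 1) : ℝ) * ((i + 1)! : ℝ) * ((n - i)! : ℝ) = (n + 1)! := by
    have := Nat.choose_mul_factorial_mul_factorial (show i + 1 ≤ n + 1 by omega)
    rw [show n + 1 - (i + 1) = n - i by omega] at this
    exact_mod_cast this
  have h2 : ((i + 1)! : ℝ) * ((n - i)! : ℝ) ≤ n ! := by exact_mod_cast factorial_succ_mul_factorial_sub_le n i hi
  calc ((n + 1).choose (i + 1) : ℝ) * ((i + 1)! : ℝ) ^ 2 * ((n - i)! : ℝ) ^ 2
      = (((n + 1).choose (i + 1) : ℝ) * ((i + 1)! : ℝ) * ((n - i)! : ℝ)) * (((i + 1)! : ℝ) * ((n - i)! : ℝ)) := by ring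
    _ ≤ (n + 1)! * n ! := by rw [h1]; exact mul_le_mul_of_nonneg_left h2 (by positivity)

/-- The jets of `u ↦ u² + lo²`: `2u`, `2`, then `0`; in bound form `|∂ⁿ⁺¹(u²+lo²)| ≤ 2·m̃(u)²·(1/m̃(u))ⁿ⁺¹`. [folklore] -/
theorem abs_iteratedDeriv_sq_add_const_le {lo : ℝ} (hlo : 0 < lo) (n : ℕ) (u : ℝ) :
    |iteratedDeriv (n + 1) (fun x : ℝ => x ^ 2 + lo ^ 2) u| ≤ 2 * ppSmoothScale lo u ^ 2 * (1 / ppSmoothScale lo u) ^ (n + 1) := by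
  have hs := ppSmoothScale_pos hlo u
  have hus : |u| ≤ ppSmoothScale lo u := abs_le_ppSmoothScale lo u
  have hadd : iteratedDeriv (n + 1) (fun x : ℝ => x ^ 2 + lo ^ 2) u =
      iteratedDeriv (n + 1) (fun x : ℝ => x ^ 2) u + iteratedDeriv (n + 1) (fun _ : ℝ => lo ^ 2) u := by
    have h := iteratedDeriv_add (n := n + 1) (x := u) (f := fun x : ℝ => x ^ 2) (g := fun _ : ℝ => lo ^ 2)
      (contDiff_id.pow 2).contDiffAt contDiff_const.contDiffAt
    exact h
  rw [hadd, iteratedDeriv_const, if_neg (Nat.succ_ne_zero n), add_zero, iteratedDeriv_pow]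
  rcases n with _ | n
  · -- first derivative `2u`
    simp only [zero_add, Nat.descFactorial_one, Nat.cast_ofNat, pow_one]
    rw [show (2 : ℕ) - 1 = 1 from rfl, pow_one, abs_mul, abs_two]
    calc 2 * |u| ≤ 2 * ppSmoothScale lo u := by gcongr
      _ = 2 * ppSmoothScale lo u ^ 2 * (1 / ppSmoothScale lo u) := by field_simp
  · rcases n with _ | n
    · -- second derivative `2`
      have hd : (2 : ℕ).descFactorial 2 = 2 := by decide
      rw [hd, show (2 : ℕ) - (0 + 1 + 1) = 0 from rfl, pow_zero, mul_one, Nat.cast_ofNat, abs_two, show (0 + 1 + 1 : ℕ) = 2 from rfl,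
        one_div_pow]
      exact le_of_eq (by field_simp)
    · -- higher derivatives vanish
      have hd : (2 : ℕ).descFactorial (n + 1 + 1 + 1) = 0 := Nat.descFactorial_eq_zero_iff_lt.2 (by omega)
      rw [hd, Nat.cast_zero, zero_mul, abs_zero]
      positivity

/-! ## §2 The smooth floor `m̃(u) = √(u²+lo²)` has Gevrey-2 jets at every order -/

/-- The numeric step of the recursion: `2 + n·(n+1)!·n! ≤ 2·((n+1)!)²`. [folklore] -/
theorem two_add_mul_factorial_le (n : ℕ) : (2 : ℝ) + n * (n + 1)! * n ! ≤ 2 * ((n + 1)! : ℝ) ^ 2 := by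
  rw [Nat.factorial_succ]
  push_cast
  have hF : (1 : ℝ) ≤ n ! := by exact_mod_cast Nat.succ_le_of_lt (Nat.factorial_pos n)
  have hn : (0 : ℝ) ≤ n := Nat.cast_nonneg n
  nlinarith [mul_nonneg hn (mul_nonneg (zero_le_one.trans hF) (zero_le_one.trans hF)), mul_le_mul hF hF zero_le_one (zero_le_one.trans hF)]

/-- **GEVREY-2 JETS OF THE SMOOTH FLOOR**: `|∂ᵤⁿ m̃(u)| ≤ (n!)²·m̃(u)·(1/m̃(u))ⁿ` for every `n` and every `u` (`0 < lo`). [folklore] -/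
theorem abs_iteratedDeriv_ppSmoothScale_le {lo : ℝ} (hlo : 0 < lo) (n : ℕ) (u : ℝ) :
    |iteratedDeriv n (ppSmoothScale lo) u| ≤ ((n ! : ℝ)) ^ 2 * ppSmoothScale lo u * (1 / ppSmoothScale lo u) ^ n := by
  induction n using Nat.strong_induction_on with
  | _ n ih =>
    have hs := ppSmoothScale_pos hlo u
    rcases n with _ | n
    · simp [abs_of_pos hs]
    · -- the Leibniz identity for `m̃·m̃ = u² + lo²` at order `n+1`
      have hcd : ContDiff ℝ ((n + 1 : ℕ) : ℕ∞) (ppSmoothScale lo) := contDiff_ppSmoothScale hlo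
      have hsq : (fun x : ℝ => ppSmoothScale lo x * ppSmoothScale lo x) = fun x : ℝ => x ^ 2 + lo ^ 2 := by
        funext x; rw [← sq, ppSmoothScale_sq]
      have hleib := iteratedDeriv_fun_mul (n := n + 1) (x := u) hcd.contDiffAt hcd.contDiffAt
      rw [hsq, Finset.sum_range_succ, Finset.sum_range_succ', Nat.choose_self, Nat.choose_zero_right, Nat.cast_one, one_mul, one_mul,
        Nat.sub_self, Nat.sub_zero, iteratedDeriv_zero] at hleib
      -- `hleib : q = (Σ_{i<n} mid (i+1)) + m̃·∂ⁿ⁺¹m̃ ... + ∂ⁿ⁺¹m̃·m̃`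
      set D := iteratedDeriv (n + 1) (ppSmoothScale lo) u with hD
      set S := ∑ i ∈ Finset.range n, ((n + 1).choose (i + 1) : ℝ) * iteratedDeriv (i + 1) (ppSmoothScale lo) u *
        iteratedDeriv (n + 1 - (i + 1)) (ppSmoothScale lo) u with hS
      have hq := abs_iteratedDeriv_sq_add_const_le hlo n u
      have hkey : 2 * ppSmoothScale lo u * D = iteratedDeriv (n + 1) (fun x : ℝ => x ^ 2 + lo ^ 2) u - S := by
        rw [hleib]; ring
      -- the middle terms by the induction hypothesis
      have hmid : ∀ i ∈ Finset.range n, |((n + 1).choose (i + 1) : ℝ) * iteratedDeriv (i + 1) (ppSmoothScale lo) u *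
          iteratedDeriv (n + 1 - (i + 1)) (ppSmoothScale lo) u| ≤ ((n + 1)! * n ! : ℝ) * (ppSmoothScale lo u ^ 2 * (1 / ppSmoothScale lo u) ^ (n + 1)) := by
        intro i hi
        have hin : i < n := Finset.mem_range.1 hi
        have h1 := ih (i + 1) (by omega)
        have h2 := ih (n + 1 - (i + 1)) (by omega)
        rw [show n + 1 - (i + 1) = n - i by omega] at h2 ⊢
        rw [abs_mul, abs_mul, Nat.abs_cast]
        calc ((n + 1).choose (i + 1) : ℝ) * |iteratedDeriv (i + 1) (ppSmoothScale lo) u| * |iteratedDeriv (n - i) (ppSmoothScale lo) u|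
            ≤ ((n + 1).choose (i + 1) : ℝ) * ((((i + 1)! : ℝ)) ^ 2 * ppSmoothScale lo u * (1 / ppSmoothScale lo u) ^ (i + 1)) *
                ((((n - i)! : ℝ)) ^ 2 * ppSmoothScale lo u * (1 / ppSmoothScale lo u) ^ (n - i)) := by gcongr
          _ = (((n + 1).choose (i + 1) : ℝ) * ((i + 1)! : ℝ) ^ 2 * ((n - i)! : ℝ) ^ 2) *
                (ppSmoothScale lo u ^ 2 * ((1 / ppSmoothScale lo u) ^ (i + 1) * (1 / ppSmoothScale lo u) ^ (n - i))) := by ring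
          _ = (((n + 1).choose (i + 1) : ℝ) * ((i + 1)! : ℝ) ^ 2 * ((n - i)! : ℝ) ^ 2) *
                (ppSmoothScale lo u ^ 2 * (1 / ppSmoothScale lo u) ^ (n + 1)) := by rw [← pow_add, show i + 1 + (n - i) = n + 1 by omega]
          _ ≤ ((n + 1)! * n ! : ℝ) * (ppSmoothScale lo u ^ 2 * (1 / ppSmoothScale lo u) ^ (n + 1)) :=
              mul_le_mul_of_nonneg_right (choose_mul_sq_factorial_le hin) (by positivity)
      have hSb : |S| ≤ n * (((n + 1)! * n ! : ℝ) * (ppSmoothScale lo u ^ 2 * (1 / ppSmoothScale lo u) ^ (n + 1))) := by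
        refine (Finset.abs_sum_le_sum_abs _ _).trans ?_
        have h := Finset.sum_le_sum hmid
        rwa [Finset.sum_const, Finset.card_range, nsmul_eq_mul] at h
      -- solve for `D`
      have habs : 2 * ppSmoothScale lo u * |D| ≤ (2 + n * (n + 1)! * n !) * (ppSmoothScale lo u ^ 2 * (1 / ppSmoothScale lo u) ^ (n + 1)) := by
        have h1 : 2 * ppSmoothScale lo u * |D| = |2 * ppSmoothScale lo u * D| := by
          rw [abs_mul, abs_of_pos (by positivity : (0 : ℝ) < 2 * ppSmoothScale lo u)]
        rw [h1, hkey]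
        refine (abs_sub _ _).trans ?_
        calc |iteratedDeriv (n + 1) (fun x : ℝ => x ^ 2 + lo ^ 2) u| + |S|
            ≤ 2 * ppSmoothScale lo u ^ 2 * (1 / ppSmoothScale lo u) ^ (n + 1) +
                n * (((n + 1)! * n ! : ℝ) * (ppSmoothScale lo u ^ 2 * (1 / ppSmoothScale lo u) ^ (n + 1))) := add_le_add hq hSb
          _ = (2 + n * (n + 1)! * n !) * (ppSmoothScale lo u ^ 2 * (1 / ppSmoothScale lo u) ^ (n + 1)) := by ring
      have hnum := two_add_mul_factorial_le n
      have hfin : 2 * ppSmoothScale lo u * |D| ≤ 2 * ppSmoothScale lo u * ((((n + 1)! : ℝ)) ^ 2 * ppSmoothScale lo u * (1 / ppSmoothScale lo u) ^ (n + 1)) := by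
        refine habs.trans ?_
        have h0 : 0 ≤ ppSmoothScale lo u ^ 2 * (1 / ppSmoothScale lo u) ^ (n + 1) := by positivity
        calc (2 + n * (n + 1)! * n !) * (ppSmoothScale lo u ^ 2 * (1 / ppSmoothScale lo u) ^ (n + 1))
            ≤ (2 * ((n + 1)! : ℝ) ^ 2) * (ppSmoothScale lo u ^ 2 * (1 / ppSmoothScale lo u) ^ (n + 1)) := mul_le_mul_of_nonneg_right hnum h0
          _ = 2 * ppSmoothScale lo u * ((((n + 1)! : ℝ)) ^ 2 * ppSmoothScale lo u * (1 / ppSmoothScale lo u) ^ (n + 1)) := by ring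
      exact le_of_mul_le_mul_left hfin (by positivity)

/-- `m̃` is `C^∞` in the form `fun u => ppSmoothScale lo u` (binder shape of the compositions below). [folklore] -/
theorem abs_iteratedDeriv_ppSmoothScale_le' {lo : ℝ} (hlo : 0 < lo) (n : ℕ) (u : ℝ) :
    |iteratedDeriv n (fun v : ℝ => ppSmoothScale lo v) u| ≤ ((n ! : ℝ)) ^ 2 * ppSmoothScale lo u * (1 / ppSmoothScale lo u) ^ n :=
  abs_iteratedDeriv_ppSmoothScale_le hlo n u

/-! ## §3 The split ratio `r(e,u) = m̃ₑ/(m̃ₑ+m̃ᵤ)` at every order -/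

/-- The denominator `u ↦ m̃ₑ + m̃(u)`: smooth, `= m̃ₑ+m̃ᵤ > 0`, jets (orders `≥ 1`) those of `m̃`. [folklore] -/
theorem abs_iteratedDeriv_ppSmoothScale_add_le {lo : ℝ} (hlo : 0 < lo) (e : ℝ) {i : ℕ} (hi : 1 ≤ i) (u : ℝ) :
    |iteratedDeriv i (fun v : ℝ => ppSmoothScale lo e + ppSmoothScale lo v) u| ≤
      ppSmoothScale lo u * ((i ! : ℝ)) ^ 2 * (1 / ppSmoothScale lo u) ^ i := by
  have hcd : ContDiff ℝ (i : ℕ∞) (ppSmoothScale lo) := contDiff_ppSmoothScale hlo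
  have h : iteratedDeriv i (fun v : ℝ => ppSmoothScale lo e + ppSmoothScale lo v) u = iteratedDeriv i (ppSmoothScale lo) u := by
    have hf : (fun v : ℝ => ppSmoothScale lo e + ppSmoothScale lo v) = (fun _ : ℝ => ppSmoothScale lo e) + ppSmoothScale lo := rfl
    rw [hf, iteratedDeriv_add contDiff_const.contDiffAt hcd.contDiffAt, iteratedDeriv_const, if_neg (by omega), zero_add]
  rw [h]
  calc |iteratedDeriv i (ppSmoothScale lo) u| ≤ ((i ! : ℝ)) ^ 2 * ppSmoothScale lo u * (1 / ppSmoothScale lo u) ^ i :=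
        abs_iteratedDeriv_ppSmoothScale_le hlo i u
    _ = ppSmoothScale lo u * ((i ! : ℝ)) ^ 2 * (1 / ppSmoothScale lo u) ^ i := by ring

/-- **GEVREY-2 JETS OF THE SPLIT RATIO**: `|∂ᵤⁿ r(e,·)(u)| ≤ (n!)²·(2/m̃(u))ⁿ` for every `n, e, u` (`0 < lo`). [folklore] -/
theorem abs_iteratedDeriv_ppSmoothRatio_le {lo : ℝ} (hlo : 0 < lo) (e : ℝ) (n : ℕ) (u : ℝ) :
    |iteratedDeriv n (fun v : ℝ => ppSmoothRatio lo e v) u| ≤ ((n ! : ℝ)) ^ 2 * (2 / ppSmoothScale lo u) ^ n := by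
  have ha := ppSmoothScale_pos hlo e
  have hs := ppSmoothScale_pos hlo u
  set a := ppSmoothScale lo e with ha_def
  set s := ppSmoothScale lo u with hs_def
  -- `r = a · (a + m̃)⁻¹`
  have hfun : (fun v : ℝ => ppSmoothRatio lo e v) = fun v : ℝ => a * (ppSmoothScale lo e + ppSmoothScale lo v)⁻¹ := by
    funext v; simp only [ppSmoothRatio, div_eq_mul_inv, ha_def]
  rw [hfun, iteratedDeriv_const_mul_field, abs_mul, abs_of_pos ha]
  -- the reciprocal rule
  have hf : ContDiff ℝ (⊤ : ℕ∞) (fun v : ℝ => ppSmoothScale lo e + ppSmoothScale lo v) := contDiff_const.add (contDiff_ppSmoothScale hlo)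
  have hd : 0 < a + s := by positivity
  have hfx : a + s ≤ |(fun v : ℝ => ppSmoothScale lo e + ppSmoothScale lo v) u| := by
    simp only [← ha_def, ← hs_def]; rw [abs_of_pos hd]
  have hinv := abs_iteratedDeriv_inv_le_of_gevrey_two hf hd hs.le (by positivity : (0 : ℝ) ≤ 1 / s) hfx n
    (fun i hi1 _ => abs_iteratedDeriv_ppSmoothScale_add_le hlo e hi1 u)
  -- `σ(1 + B/d) = (1/s)(1 + s/(a+s)) ≤ 2/s`
  have hσ : 1 / s * (1 + s / (a + s)) ≤ 2 / s := by
    rw [div_mul_eq_mul_div, one_mul, div_le_div_iff_of_pos_right hs]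
    have : s / (a + s) ≤ 1 := (div_le_one hd).2 (by linarith)
    linarith
  calc a * |iteratedDeriv n (fun v : ℝ => (ppSmoothScale lo e + ppSmoothScale lo v)⁻¹) u|
      ≤ a * ((a + s)⁻¹ * ((n ! : ℝ)) ^ 2 * (1 / s * (1 + s / (a + s))) ^ n) := mul_le_mul_of_nonneg_left hinv ha.le
    _ ≤ a * ((a + s)⁻¹ * ((n ! : ℝ)) ^ 2 * (2 / s) ^ n) := by gcongr
    _ = (a / (a + s)) * (((n ! : ℝ)) ^ 2 * (2 / s) ^ n) := by rw [div_eq_mul_inv]; ring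
    _ ≤ 1 * (((n ! : ℝ)) ^ 2 * (2 / s) ^ n) := mul_le_mul_of_nonneg_right ((div_le_one hd).2 (by linarith)) (by positivity)
    _ = ((n ! : ℝ)) ^ 2 * (2 / s) ^ n := one_mul _

/-- The complementary ratio `1 − r(e,·)` (`= m̃ᵤ/(m̃ₑ+m̃ᵤ) = r(u,e)` read in its first slot): same jets at orders `≥ 1`, `|1 − r| ≤ 1` at order `0`. [folklore] -/
theorem abs_iteratedDeriv_one_sub_ppSmoothRatio_le {lo : ℝ} (hlo : 0 < lo) (e : ℝ) (n : ℕ) (u : ℝ) :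
    |iteratedDeriv n (fun v : ℝ => 1 - ppSmoothRatio lo e v) u| ≤ ((n ! : ℝ)) ^ 2 * (2 / ppSmoothScale lo u) ^ n := by
  rcases Nat.eq_zero_or_pos n with rfl | hn
  · have h := ppSmoothRatio_mem_Ioo hlo e u
    simp only [iteratedDeriv_zero, Nat.factorial_zero, Nat.cast_one, one_pow, pow_zero, mul_one]
    rw [abs_le]; constructor <;> linarith [h.1, h.2]
  · have hcd : ContDiff ℝ (n : ℕ∞) (fun v : ℝ => ppSmoothRatio lo e v) := contDiff_ppSmoothRatio hlo e
    have h : iteratedDeriv n (fun v : ℝ => 1 - ppSmoothRatio lo e v) u = -iteratedDeriv n (fun v : ℝ => ppSmoothRatio lo e v) u := by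
      have := iteratedDeriv_sub (n := n) (x := u) (f := fun _ : ℝ => (1 : ℝ)) (g := fun v : ℝ => ppSmoothRatio lo e v)
        contDiff_const.contDiffAt hcd.contDiffAt
      rw [iteratedDeriv_const, if_neg (by omega), zero_sub] at this
      exact this
    rw [h, abs_neg]
    exact abs_iteratedDeriv_ppSmoothRatio_le hlo e n u

/-- **ZONE FORM**: on a zone `c·(m̃ₑ+m̃ᵤ) ≤ m̃ᵤ` (`0 < c`), `|∂ᵤⁿ r(e,·)(u)| ≤ (n!)²·(2/c)ⁿ·(1/(m̃ₑ+m̃ᵤ))ⁿ` — the transition zones of `κ(r)` (`m̃ᵤ ≥ (1−t₁)(m̃ₑ+m̃ᵤ)`)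
and of `κ(1−r)` (`m̃ᵤ ≥ (t₁/2)(m̃ₑ+m̃ᵤ)`) are of this kind. [folklore] -/
theorem abs_iteratedDeriv_ppSmoothRatio_le_of_zone {lo : ℝ} (hlo : 0 < lo) {c : ℝ} (hc : 0 < c) {e u : ℝ}
    (hz : c * (ppSmoothScale lo e + ppSmoothScale lo u) ≤ ppSmoothScale lo u) (n : ℕ) :
    |iteratedDeriv n (fun v : ℝ => ppSmoothRatio lo e v) u| ≤ ((n ! : ℝ)) ^ 2 * (2 / c) ^ n * (1 / (ppSmoothScale lo e + ppSmoothScale lo u)) ^ n := by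
  have ha := ppSmoothScale_pos hlo e
  have hs := ppSmoothScale_pos hlo u
  refine (abs_iteratedDeriv_ppSmoothRatio_le hlo e n u).trans ?_
  rw [mul_assoc, ← mul_pow]
  have h : 2 / ppSmoothScale lo u ≤ 2 / c * (1 / (ppSmoothScale lo e + ppSmoothScale lo u)) := by
    rw [div_mul_div_comm, mul_one, div_le_div_iff₀ hs (by positivity)]
    nlinarith
  gcongr

/-- The same zone form for `1 − r` . [folklore] -/
theorem abs_iteratedDeriv_one_sub_ppSmoothRatio_le_of_zone {lo : ℝ} (hlo : 0 < lo) {c : ℝ} (hc : 0 < c) {e u : ℝ}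
    (hz : c * (ppSmoothScale lo e + ppSmoothScale lo u) ≤ ppSmoothScale lo u) (n : ℕ) :
    |iteratedDeriv n (fun v : ℝ => 1 - ppSmoothRatio lo e v) u| ≤ ((n ! : ℝ)) ^ 2 * (2 / c) ^ n * (1 / (ppSmoothScale lo e + ppSmoothScale lo u)) ^ n := by
  have ha := ppSmoothScale_pos hlo e
  have hs := ppSmoothScale_pos hlo u
  refine (abs_iteratedDeriv_one_sub_ppSmoothRatio_le hlo e n u).trans ?_
  rw [mul_assoc, ← mul_pow]
  have h : 2 / ppSmoothScale lo u ≤ 2 / c * (1 / (ppSmoothScale lo e + ppSmoothScale lo u)) := by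
    rw [div_mul_div_comm, mul_one, div_le_div_iff₀ hs (by positivity)]
    nlinarith
  gcongr

/-- **Level form of the zone denominator**: `(1/(m̃ₑ+m̃ᵤ))ⁿ ≤ ((max |e| |u|)⁻¹)ⁿ` (`e ≠ 0`) and `≤ ((max lo |u|)⁻¹)ⁿ` — the two currencies of the law rows. [folklore] -/
theorem inv_ppSmoothScale_add_pow_le {lo : ℝ} (hlo : 0 < lo) (e u : ℝ) (n : ℕ) :
    (e ≠ 0 → (1 / (ppSmoothScale lo e + ppSmoothScale lo u)) ^ n ≤ ((max |e| |u|)⁻¹) ^ n) ∧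
      (1 / (ppSmoothScale lo e + ppSmoothScale lo u)) ^ n ≤ ((max lo |u|)⁻¹) ^ n := by
  have ha := ppSmoothScale_pos hlo e
  have hs := ppSmoothScale_pos hlo u
  have h0 : 0 ≤ 1 / (ppSmoothScale lo e + ppSmoothScale lo u) := by positivity
  refine ⟨fun he => pow_le_pow_left₀ h0 (inv_ppSmoothScale_add_le_inv_max hlo he u) n, pow_le_pow_left₀ h0 ?_ n⟩
  have hM : 0 < max lo |u| := lt_max_of_lt_left hlo
  rw [one_div, inv_le_inv₀ (by positivity) hM]
  have h1 : lo ≤ ppSmoothScale lo e := le_ppSmoothScale hlo.le e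
  have h2 : |u| ≤ ppSmoothScale lo u := abs_le_ppSmoothScale lo u
  have h3 : lo ≤ ppSmoothScale lo u := le_ppSmoothScale hlo.le u
  exact max_le (by linarith) (by linarith)

end Summit.HubbardSuperconductivity.HubbardSuperconductivity.Theorems.C4a

end
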